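import Mathlib
import HarnessLib
import Literature.MathematicalPhysics.QuantumLattice.GrassmannQuarticWick
import Literature.MathematicalPhysics.QuantumLattice.HubbardGridCounterQuadratic
import Literature.MathematicalPhysics.QuantumLattice.HubbardGridInteractionKernels
import Literature.MathematicalPhysics.QuantumLattice.GrassmannEffectiveAction

/-!
# K3 engine (stmt-HubbardSuperconductivity-19918 and its gen-6 successor), stub `stub_twoLeg_scale0`: the two-leg kernel of the scale-`0`
# grid output `W_N − 𝒩_{K,N}` — the first-order (tadpole) part is GRID-DIAGONAL, so off the diagonal only the truncated step is seen

Cell gate-hubbard-kl, seat p3 (g7); the algebraic half of the «four pinned grid sums» of the two-leg exports (p1b g7's hand-off, STATUS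
06:28:17Z (ii)).  On the `N`-point time grid, with the grid vertex `Ṽ = V_N + 𝒩_{K,N}` (`hubbardGridInteraction` + `hubbardGridCounterQuadratic`),
ANY covariance `C` on the grid legs and the grid effective action `W = effAction C Ṽ`, the element the two-leg slot reads at scale `0` is
`W' = W − 𝒩_{K,N}` (`…TwoLegTimeMomentFromGrid.klEffectiveAction_zero_sub_counterQuadratic_eq_map_gridSub`).  Its two-leg kernel splits as

  `kernel₂ (W − 𝒩_{K,N}) = kernel₂ (W − e^{Δ_C} Ṽ) + kernel₂ (e^{Δ_C} Ṽ − Ṽ)`      (`kernel₂ V_N = 0`: the quartic has no two-leg kernel),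

and the second (first-order, tadpole) term is supported on GRID-DIAGONAL pairs — both legs at the same grid point: by Wick's rule for a quartic
monomial (`gaussConv_gen_four`, any `C`) every quadratic monomial produced from `ψ⁺↑ψ⁻↑ψ⁺↓ψ⁻↓(p)` has both generators at `p`, and the
Gaussian convolution of the quadratic counterterm is itself plus a constant (`gaussConv_gen_mul_gen`).  Hence for every pair `Y` with
`(Y 0).point ≠ (Y 1).point`:  `kernel₂ (W − 𝒩_{K,N}) Y = kernel₂ (W − e^{Δ_C} Ṽ) Y` — the OFF-DIAGONAL spatial moments and the TEMPORAL moment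
(circular grid distance, which vanishes on the diagonal) of the two-leg exports see only the truncated step, which carries one power of
`θ = O(U)` more than the full step (`GrassmannWeightedEffectiveActionTruncationDB`).

* `kernel_sub_apply`, `kernel_succ_gaussConv_structuredQuadratic` (`kernel_{m+1} (e^{Δ_C} Q) = kernel_{m+1} Q` for `Q = Σ c_i ψ(a_i)ψ(b_i)`);
* `kernel_two_gen_mul_gen_eq_zero_of_point_ne` (a monomial `ψ(a)ψ(b)` with `a, b` at one grid point has no off-diagonal two-leg kernel);
* `kernel_two_gaussConv_gridWord_eq_zero_of_ne`, `kernel_two_gridWord` (`= 0`), `kernel_two_gaussConv_hubbardGridInteraction_eq_zero_of_ne`;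
* `kernel_succ_gaussConv_hubbardGridCounterQuadratic` (`kernel_{m+1} (e^{Δ_C} 𝒩_{K,N}) = kernel_{m+1} 𝒩_{K,N}`);
* **`kernel_two_gaussConv_gridVertex_sub_self_eq_zero_of_ne`** — `(Y 0).point ≠ (Y 1).point → kernel₂ (e^{Δ_C} Ṽ − Ṽ) Y = 0`;
* **`kernel_two_effAction_sub_counter_eq`** — `kernel₂ (W − 𝒩_{K,N}) Y = kernel₂ (W − e^{Δ_C} Ṽ) Y + kernel₂ (e^{Δ_C} Ṽ − Ṽ) Y` (every `Y`);
* **`kernel_two_effAction_sub_counter_eq_of_ne`** — `(Y 0).point ≠ (Y 1).point → kernel₂ (W − 𝒩_{K,N}) Y = kernel₂ (W − e^{Δ_C} Ṽ) Y`.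

Pure Grassmann algebra; nothing about the model is asserted.  References: Salmhofer 1999 §4.3 (4.44) (Wick's rule) [cite: Salmhofer1999];
BGM 2006 (2.86)–(2.88) (the tadpole part of the flow) [cite: BenfattoGiulianiMastropietro2006].
-/

noncomputable section

namespace Summit.HubbardSuperconductivity.HubbardSuperconductivity.Theorems.EngineV8

set_option linter.dupNamespace false -- summit = problem name (single-conjunct summit), D-0017

open Finset Literature.MathematicalPhysics.QuantumLattice Literature.Probability.LatticeModels GrassmannAlgebra

variable {L N : ℕ}

/-! ## §1 Generic kernel bookkeeping -/

/-- Kernels are additive: `kernel (F − G) = kernel F − kernel G`. -/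
theorem kernel_sub_apply {Γ : Type*} [Fintype Γ] [DecidableEq Γ] (F G : GrassmannAlgebra ℂ Γ) (m : ℕ) (X : Fin m → Γ) :
    kernel ℂ (F - G) m X = kernel ℂ F m X - kernel ℂ G m X := by
  rw [sub_eq_add_neg, kernel_add, ← neg_one_smul ℂ G, kernel_smul]
  ring

/-- Constants have no two-leg kernel. -/
theorem kernel_two_algebraMap {Γ : Type*} [Fintype Γ] [DecidableEq Γ] (r : ℂ) (Y : Fin 2 → Γ) :
    kernel ℂ (algebraMap ℂ (GrassmannAlgebra ℂ Γ) r) 2 Y = 0 :=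
  kernel_algebraMap_succ ℂ r 1 Y

/-- **The Gaussian convolution of a structured quadratic is itself plus a constant**: for `Q = Σ_{i ∈ s} c_i • ψ(a_i)ψ(b_i)` and every
covariance `C`, `kernel_{m+1} (e^{Δ_C} Q) = kernel_{m+1} Q` (`gaussConv_gen_mul_gen`: `e^{Δ_C}(ψ_aψ_b) = ψ_aψ_b + const`). -/
theorem kernel_succ_gaussConv_structuredQuadratic {Γ : Type*} [Fintype Γ] [DecidableEq Γ] {ι : Type*} (s : Finset ι) (c : ι → ℂ)
    (a b : ι → Γ) (C : Matrix Γ Γ ℂ) (m : ℕ) (X : Fin (m + 1) → Γ) :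
    kernel ℂ (gaussConv ℂ C (∑ i ∈ s, c i • (gen ℂ (a i) * gen ℂ (b i)))) (m + 1) X =
      kernel ℂ (∑ i ∈ s, c i • (gen ℂ (a i) * gen ℂ (b i))) (m + 1) X := by
  rw [map_sum, kernel_sum, kernel_sum]
  refine sum_congr rfl fun i _ => ?_
  rw [map_smul, kernel_smul, kernel_smul, gaussConv_gen_mul_gen, kernel_add, kernel_algebraMap_succ, add_zero]

/-- **A monomial `ψ(a)ψ(b)` with both legs at one grid point has no two-leg kernel at a pair of legs at DIFFERENT grid points.** -/
theorem kernel_two_gen_mul_gen_eq_zero_of_point_ne (a b : GridLeg (GridPoint L N)) (hab : a.1.1 = b.1.1)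
    (Y : Fin 2 → GridLeg (GridPoint L N)) (hY : (Y 0).1.1 ≠ (Y 1).1.1) :
    kernel ℂ (gen ℂ a * gen ℂ b) 2 Y = 0 := by
  rw [kernel_two_gen_mul_gen]
  by_cases h0 : Y 0 = a
  · by_cases h1 : Y 1 = b
    · exact absurd (by rw [h0, h1, hab]) hY
    · have h1' : ¬Y 1 = a := fun h => hY (by rw [h0, h])
      simp [h1, h1']
  · by_cases h0' : Y 0 = b
    · by_cases h1 : Y 1 = a
      · exact absurd (by rw [h0', h1, hab]) hY
      · simp [h0, h1]
    · simp [h0, h0']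

/-! ## §2 The quartic grid word: no two-leg kernel, and its Gaussian convolution has none off the diagonal -/

/-- The quartic grid word has no two-leg kernel. -/
theorem kernel_two_gridWord (p : GridPoint L N) (Y : Fin 2 → GridLeg (GridPoint L N)) : kernel ℂ (gridWord L N p) 2 Y = 0 := by
  rw [gridWord_eq_genProd, kernel_genProd_of_ne ℂ Y _ (by norm_num)]

/-- **Wick's rule at one grid point, off the diagonal**: for every covariance `C`, the two-leg kernel of `e^{Δ_C}(ψ⁺↑ψ⁻↑ψ⁺↓ψ⁻↓(p))` vanishes at
every pair of legs at different grid points (all six contraction monomials of `gaussConv_gen_four` live at `p`; the quartic and the constant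
have no two-leg kernel). -/
theorem kernel_two_gaussConv_gridWord_eq_zero_of_ne [NeZero L] (C : Matrix (GridLeg (GridPoint L N)) (GridLeg (GridPoint L N)) ℂ)
    (p : GridPoint L N) (Y : Fin 2 → GridLeg (GridPoint L N)) (hY : (Y 0).1.1 ≠ (Y 1).1.1) :
    kernel ℂ (gaussConv ℂ C (gridWord L N p)) 2 Y = 0 := by
  have hz : ∀ (a b : GridLeg (GridPoint L N)), a.1.1 = p → b.1.1 = p → kernel ℂ (gen ℂ a * gen ℂ b) 2 Y = 0 :=
    fun a b ha hb => kernel_two_gen_mul_gen_eq_zero_of_point_ne a b (ha.trans hb.symm) Y hY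
  rw [gridWord, gaussConv_gen_four]
  simp only [kernel_add, kernel_sub_apply, kernel_smul]
  rw [show gen ℂ (((p, 0), 0) : GridLeg (GridPoint L N)) * gen ℂ (((p, 0), 1) : GridLeg (GridPoint L N)) *
      gen ℂ (((p, 1), 0) : GridLeg (GridPoint L N)) * gen ℂ (((p, 1), 1) : GridLeg (GridPoint L N)) = gridWord L N p from rfl,
    kernel_two_gridWord, hz _ _ rfl rfl, hz _ _ rfl rfl, hz _ _ rfl rfl, hz _ _ rfl rfl, hz _ _ rfl rfl, hz _ _ rfl rfl,
    kernel_two_algebraMap]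
  simp

/-- **The Gaussian convolution of the grid quartic has no off-diagonal two-leg kernel** (any `C`; the tadpole `U ε_N Σ_p t_p ψ⁺ψ⁻(p)` is grid-diagonal). -/
theorem kernel_two_gaussConv_hubbardGridInteraction_eq_zero_of_ne [NeZero L]
    (C : Matrix (GridLeg (GridPoint L N)) (GridLeg (GridPoint L N)) ℂ) (β U : ℝ) (Y : Fin 2 → GridLeg (GridPoint L N))
    (hY : (Y 0).1.1 ≠ (Y 1).1.1) :
    kernel ℂ (gaussConv ℂ C (hubbardGridInteraction L N β U)) 2 Y = 0 := by
  rw [hubbardGridInteraction, map_smul, map_sum, kernel_smul, kernel_sum]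
  rw [sum_eq_zero fun p _ => kernel_two_gaussConv_gridWord_eq_zero_of_ne C p Y hY, mul_zero]

/-! ## §3 The counterterm: its Gaussian convolution is itself plus a constant -/

/-- **`kernel_{m+1} (e^{Δ_C} 𝒩_{K,N}) = kernel_{m+1} 𝒩_{K,N}`** for every covariance `C` (the grid counterterm is a structured quadratic,
`hubbardGridCounterQuadratic_eq_sum`). -/
theorem kernel_succ_gaussConv_hubbardGridCounterQuadratic [NeZero L]
    (C : Matrix (GridLeg (GridPoint L N)) (GridLeg (GridPoint L N)) ℂ) (β : ℝ) (K : TrigPolyC4v) (m : ℕ)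
    (X : Fin (m + 1) → GridLeg (GridPoint L N)) :
    kernel ℂ (gaussConv ℂ C (hubbardGridCounterQuadratic L N β K)) (m + 1) X = kernel ℂ (hubbardGridCounterQuadratic L N β K) (m + 1) X := by
  rw [hubbardGridCounterQuadratic_eq_sum]
  exact kernel_succ_gaussConv_structuredQuadratic _ _ _ _ C m X

/-- The two-leg case: `kernel₂ (e^{Δ_C} 𝒩_{K,N}) = kernel₂ 𝒩_{K,N}`. -/
theorem kernel_two_gaussConv_hubbardGridCounterQuadratic [NeZero L]
    (C : Matrix (GridLeg (GridPoint L N)) (GridLeg (GridPoint L N)) ℂ) (β : ℝ) (K : TrigPolyC4v) (Y : Fin 2 → GridLeg (GridPoint L N)) :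
    kernel ℂ (gaussConv ℂ C (hubbardGridCounterQuadratic L N β K)) 2 Y = kernel ℂ (hubbardGridCounterQuadratic L N β K) 2 Y :=
  kernel_succ_gaussConv_hubbardGridCounterQuadratic C β K 1 Y

/-! ## §4 The grid vertex `Ṽ = V_N + 𝒩_{K,N}` and the scale-`0` output `W − 𝒩_{K,N}` -/

/-- **The first-order (tadpole) part of the step is grid-diagonal**: for every covariance `C` on the grid legs and every pair `Y` of legs at
different grid points, `kernel₂ (e^{Δ_C} Ṽ − Ṽ) Y = 0`, `Ṽ = V_N + 𝒩_{K,N}`. -/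
theorem kernel_two_gaussConv_gridVertex_sub_self_eq_zero_of_ne [NeZero L]
    (C : Matrix (GridLeg (GridPoint L N)) (GridLeg (GridPoint L N)) ℂ) (β U : ℝ) (K : TrigPolyC4v) (Y : Fin 2 → GridLeg (GridPoint L N))
    (hY : (Y 0).1.1 ≠ (Y 1).1.1) :
    kernel ℂ (gaussConv ℂ C (hubbardGridInteraction L N β U + hubbardGridCounterQuadratic L N β K) -
        (hubbardGridInteraction L N β U + hubbardGridCounterQuadratic L N β K)) 2 Y = 0 := by
  rw [kernel_sub_apply, map_add, kernel_add, kernel_add, kernel_two_gaussConv_hubbardGridInteraction_eq_zero_of_ne C β U Y hY,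
    kernel_two_gaussConv_hubbardGridCounterQuadratic C β K Y, kernel_hubbardGridInteraction_of_ne β U (by norm_num) Y]
  ring

/-- **The two-leg kernel of the scale-`0` output, decomposed**: for every `Y`,
`kernel₂ (W − 𝒩_{K,N}) Y = kernel₂ (W − e^{Δ_C} Ṽ) Y + kernel₂ (e^{Δ_C} Ṽ − Ṽ) Y`, `W = effAction C Ṽ` (the quartic `V_N` has no two-leg kernel). -/
theorem kernel_two_effAction_sub_counter_eq [NeZero L]
    (C : Matrix (GridLeg (GridPoint L N)) (GridLeg (GridPoint L N)) ℂ) (β U : ℝ) (K : TrigPolyC4v) (Y : Fin 2 → GridLeg (GridPoint L N)) :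
    kernel ℂ (effAction ℂ C (hubbardGridInteraction L N β U + hubbardGridCounterQuadratic L N β K) - hubbardGridCounterQuadratic L N β K) 2 Y =
      kernel ℂ (effAction ℂ C (hubbardGridInteraction L N β U + hubbardGridCounterQuadratic L N β K) -
          gaussConv ℂ C (hubbardGridInteraction L N β U + hubbardGridCounterQuadratic L N β K)) 2 Y +
        kernel ℂ (gaussConv ℂ C (hubbardGridInteraction L N β U + hubbardGridCounterQuadratic L N β K) -
          (hubbardGridInteraction L N β U + hubbardGridCounterQuadratic L N β K)) 2 Y := by
  rw [kernel_sub_apply, kernel_sub_apply, kernel_sub_apply, kernel_add, kernel_hubbardGridInteraction_of_ne β U (by norm_num) Y]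
  ring

/-- **Off the grid diagonal the two-leg kernel of the scale-`0` output is the truncated step's**:
`(Y 0).point ≠ (Y 1).point → kernel₂ (W − 𝒩_{K,N}) Y = kernel₂ (W − e^{Δ_C} Ṽ) Y`. -/
theorem kernel_two_effAction_sub_counter_eq_of_ne [NeZero L]
    (C : Matrix (GridLeg (GridPoint L N)) (GridLeg (GridPoint L N)) ℂ) (β U : ℝ) (K : TrigPolyC4v) (Y : Fin 2 → GridLeg (GridPoint L N))
    (hY : (Y 0).1.1 ≠ (Y 1).1.1) :
    kernel ℂ (effAction ℂ C (hubbardGridInteraction L N β U + hubbardGridCounterQuadratic L N β K) - hubbardGridCounterQuadratic L N β K) 2 Y =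
      kernel ℂ (effAction ℂ C (hubbardGridInteraction L N β U + hubbardGridCounterQuadratic L N β K) -
          gaussConv ℂ C (hubbardGridInteraction L N β U + hubbardGridCounterQuadratic L N β K)) 2 Y := by
  rw [kernel_two_effAction_sub_counter_eq, kernel_two_gaussConv_gridVertex_sub_self_eq_zero_of_ne C β U K Y hY, add_zero]

end Summit.HubbardSuperconductivity.HubbardSuperconductivity.Theorems.EngineV8

end
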